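import Literature.Geometry.GeometricMeasureTheory.BlowUpSheetProjection
import Mathlib.MeasureTheory.Measure.Regular
import HarnessLib

/-!
# Every sheet of the blow-up limit has multiplicity at least one

Support file for the proof of the named fact
`Literature.Geometry.GeometricMeasureTheory.Federer1969_compactness_integralCurrents` along
B. White's structure-theorem-free proof of the closure theorem, end of Step 3 of
[White1989, p. 219] ("`ℒᵏ(U) ≤ lim inf ℋᵏ(W ∩ η_{x,λ}M ∩ R_t) ≤ μ(W̄ ∩ R̄_t) = α_j ℋᵏ(U)`, which
implies `α_j ≥ 1`"; [Bandara2006, proof of Thm. 4.2.1, pp. 43–44]). Setting of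
`BlowUpSheetProjection`: `σ` finite, `T = σ ∧ ξ` a cycle, blow-ups `T_l` at `a` with
`σ_{a,λ_l} → ν` vaguely, `W` a `(k+1)`-plane with orthonormal basis `e`, `c₀ = ⟨e^♭, ξ(a)⟩ ≠ 0`, and
an isolated sheet `z ∈ Wᗮ`, `ν ⌞ {dist(P_{Wᗮ}·, z) < δ} = α 𝓗^{k+1} ⌞ (z + W)`, `α ≠ 0`.

The new ingredient is the **projection hypothesis** on `σ`: there is a set `M` carrying `σ`
(`σ(Mᶜ) = 0`) with `𝓗^{k+1}(Π(A)) ≤ σ(A)` for all `A ⊆ M`, `Π = P_W` (for `σ = 𝓢^{k+1} ⌞ M`,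
Federer's spherical measure, this is "`vol_W ≤ 𝓢^{k+1}` on `W` and `𝓢(Π A) ≤ 𝓢(A)`", the two EASY
covering inequalities; it is what makes the projection of the carrier set, rather than the
isodiametric inequality, control Lebesgue measure on `W`).

* `blowUp_projection_le` — the hypothesis passes to the blow-ups: `𝓗^{k+1}(Π A) ≤ σ_{a,r}(A)` for
  `A ⊆ D⁻¹ M`, `D y = a + r y` (and `σ_{a,r}((D⁻¹M)ᶜ) = 0`, `blowUp_compl_preimage_eq_zero`);
* `abs_mul_volumeReal_sdiff_le_of_forall_testFunction` — **the carrier lemma** on `W`: if a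
  functional `Λ` on test functions satisfies `|Λ g| ≤ ρ(spt g ∩ F)` (`ρ` finite, `F` measurable:
  "`Λ` lives over `F`") and `|Λ g − β ∫ g| ≤ η` for all `g` supported in the open set `U'` with
  `|g| ≤ 1`, then `|β| vol(U' ∖ F) ≤ η` (inner/outer regularity and a smooth Urysohn function);
* **`one_le_sheetMultiplicity`** — `1 ≤ α`: with `F_l` a measurable hull of `Π(M_l ∩ spt G ∩ Π⁻¹U')`,
  `vol(U') ≤ vol(F_l) + vol(U' ∖ F_l) ≤ σ_{a,λ_l}(K₃) + η/|αc₀|` where `K₃` is the compact slab over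
  `Ū'`, and `limsup σ_{a,λ_l}(K₃) ≤ ν(K₃) = α vol(U')` (vague convergence, sheet structure); with
  `eventually_forall_abs_projectedBlowUp_sub_le` supplying `η → 0` this gives `vol(U') ≤ α vol(U')`.

Theorems only; no definitions, no named facts.

## References

* B. White, *A new proof of the compactness theorem for integral currents*, Comment. Math.
  Helv. 64 (1989) 207–220, p. 219 [White1989].
* L. Bandara, *The closure theorem for integral currents without the structure theorem*,
  B.Sc. thesis, ANU 2006, proof of Thm. 4.2.1, pp. 43–44 (held copy
  `lit paper:galaxy-pdf-8023002039701172160`) [Bandara2006].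
* H. Federer, *Geometric Measure Theory*, Springer 1969, 2.10.2, 4.1.7 [Federer1969].
-/

noncomputable section

open scoped Distributions ENNReal NNReal Topology ContDiff RealInnerProductSpace Pointwise
open MeasureTheory TopologicalSpace Set Filter Metric Function

namespace Literature.Geometry.GeometricMeasureTheory

-- Nested operator-norm instances on (duals of) `E [⋀^Fin m]→L[ℝ] ℝ`, as in `Currents.lean`.
set_option maxSynthPendingDepth 3

variable {V : Type*} [NormedAddCommGroup V] [InnerProductSpace ℝ V] [FiniteDimensional ℝ V]
  [MeasurableSpace V] [BorelSpace V] {k : ℕ}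

/-! ### The projection hypothesis passes to blow-ups -/

section Transfer

omit [FiniteDimensional ℝ V] [MeasurableSpace V] [BorelSpace V] in
/-- `Π(a + r y) = Π a + r Π y`: the projection of a dilated set is the dilated projection.
[folklore] -/
private theorem image_starProjection_image_add_smul (W : Submodule ℝ V)
    [W.HasOrthogonalProjection] (a : V) (r : ℝ) (A : Set V) :
    W.starProjection '' ((fun y : V => a + r • y) '' A) =
      (fun w : V => W.starProjection a + r • w) '' (W.starProjection '' A) := by
  rw [image_image, image_image]
  refine image_congr fun y _ => ?_
  rw [map_add, map_smul]

/-- **The projection hypothesis passes to the blow-ups.** If `𝓗^{k+1}(Π A) ≤ σ(A)` for all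
`A ⊆ M`, then for the blow-up `σ_{a,r} = r^{-(k+1)} (η_{a,r})_# σ` and every `A' ⊆ D⁻¹ M`
(`D y = a + r y`): `𝓗^{k+1}(Π A') ≤ σ_{a,r}(A')` (`Π ∘ D` is `D` followed by `Π`, and `𝓗^{k+1}`
scales by `r^{k+1}` under `D`). [cite: White1989, p. 219; Federer1969, 2.10.2] -/
theorem blowUp_projection_le (W : Submodule ℝ V) {σ : Measure V} {M : Set V}
    (hproj : ∀ A ⊆ M, (μHE[k + 1] : Measure V) (W.starProjection '' A) ≤ σ A)
    (a : V) {r : ℝ} (hr : 0 < r) {A' : Set V} (hA' : A' ⊆ (fun y : V => a + r • y) ⁻¹' M) :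
    (μHE[k + 1] : Measure V) (W.starProjection '' A') ≤ Measure.blowUp σ (k + 1) a r A' := by
  set D : V → V := fun y => a + r • y with hD
  have hDA : D '' A' ⊆ M := by
    rintro _ ⟨y, hy, rfl⟩; exact hA' hy
  have h1 := hproj _ hDA
  rw [image_starProjection_image_add_smul W a r A',
    euclideanHausdorffMeasure_image_add_smul (m := k + 1) (W.starProjection a) hr] at h1
  rw [Measure.blowUp_apply σ (k + 1) a hr]
  have hrk : ENNReal.ofReal ((r⁻¹) ^ (k + 1)) * ENNReal.ofReal (r ^ (k + 1)) = 1 := by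
    rw [← ENNReal.ofReal_mul (by positivity), ← mul_pow, inv_mul_cancel₀ hr.ne', one_pow,
      ENNReal.ofReal_one]
  calc (μHE[k + 1] : Measure V) (W.starProjection '' A')
      = ENNReal.ofReal ((r⁻¹) ^ (k + 1)) *
          (ENNReal.ofReal (r ^ (k + 1)) * (μHE[k + 1] : Measure V) (W.starProjection '' A')) := by
        rw [← mul_assoc, hrk, one_mul]
    _ ≤ ENNReal.ofReal ((r⁻¹) ^ (k + 1)) * σ (D '' A') := mul_le_mul' le_rfl h1

omit [InnerProductSpace ℝ V] [FiniteDimensional ℝ V] in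
/-- The blow-up `σ_{a,r}` is carried by `D⁻¹ M` when `σ` is carried by `M`.
[cite: White1989, p. 216] -/
theorem blowUp_compl_preimage_eq_zero [NormedSpace ℝ V] {σ : Measure V} {M : Set V} (hM : σ Mᶜ = 0)
    (m : ℕ) (a : V) {r : ℝ} (hr : 0 < r) :
    Measure.blowUp σ m a r ((fun y : V => a + r • y) ⁻¹' M)ᶜ = 0 := by
  rw [Measure.blowUp_apply σ m a hr]
  have : (fun y : V => a + r • y) '' ((fun y : V => a + r • y) ⁻¹' M)ᶜ ⊆ Mᶜ := by
    rintro _ ⟨y, hy, rfl⟩; exact hy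
  rw [measure_mono_null this hM, mul_zero]

end Transfer

/-! ### The carrier lemma on `W` -/

section Carrier

variable {P : Type*} [NormedAddCommGroup P] [InnerProductSpace ℝ P] [FiniteDimensional ℝ P]
  [MeasurableSpace P] [BorelSpace P]

/-- **The carrier lemma.** Let `U' ⊆ P` be open with `vol(U') < ∞`, `F` measurable, `ρ` a finite
measure, and `Λ` a functional on test functions with `|Λ g| ≤ ρ(spt g ∩ F)` whenever
`spt g ⊆ U'` ("`Λ` is carried over `F` with density controlled by `ρ`"). If
`|Λ g − β ∫ g| ≤ η` for all test functions `g` supported in `U'` with `|g| ≤ 1`, then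
`|β| · vol(U' ∖ F) ≤ η`: test against a smooth Urysohn function of a compact `K ⊆ U' ∖ F`
carrying almost all of its volume, supported in an open `O ⊇ U' ∖ F` with `ρ(O ∖ (U' ∖ F))` small
[White1989, p. 219: "`β ℒᵏ{x ∈ U : x ∉ Π(η_{x,λ}M ∩ R_t)} ≤ 𝐌_U(T'_λ − β[U])`"].
[cite: White1989, p. 219; Bandara2006, pp. 43–44] -/
theorem abs_mul_volumeReal_sdiff_le_of_forall_testFunction {U' F : Set P} (hU' : IsOpen U')
    (hU'fin : volume U' ≠ ⊤) (hF : MeasurableSet F) (ρ : Measure P) [IsFiniteMeasure ρ]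
    (Λ : 𝓓((⊤ : Opens P), ℝ) → ℝ)
    (hΛ : ∀ g : 𝓓((⊤ : Opens P), ℝ), tsupport (g : P → ℝ) ⊆ U' → (∀ y, |g y| ≤ 1) →
      |Λ g| ≤ (ρ (Function.support (g : P → ℝ) ∩ F)).toReal)
    {β η : ℝ} (hη : ∀ g : 𝓓((⊤ : Opens P), ℝ), tsupport (g : P → ℝ) ⊆ U' → (∀ y, |g y| ≤ 1) →
      |Λ g - β * ∫ y, g y ∂volume| ≤ η) :
    |β| * (volume (U' \ F)).toReal ≤ η := by
  set D : Set P := U' \ F with hDdef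
  have hDm : MeasurableSet D := hU'.measurableSet.diff hF
  have hDfin : volume D ≠ ⊤ := measure_ne_top_of_subset sdiff_subset hU'fin
  have hρDfin : ρ D ≠ ⊤ := measure_ne_top ρ D
  refine le_of_forall_pos_le_add fun ε hε => ?_
  -- split `ε` into the two error terms
  set ε₁ : ℝ := ε / (|β| + 1) with hε₁
  have hβ1 : 0 < |β| + 1 := by positivity
  have hε₁0 : 0 < ε₁ := div_pos hε hβ1
  have hε₁' : ENNReal.ofReal ε₁ ≠ 0 := (ENNReal.ofReal_pos.2 hε₁0).ne'
  -- a compact `K ⊆ D` with `vol(D ∖ K) < ε₁`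
  obtain ⟨K, hKD, hKc, hKvol⟩ := hDm.exists_isCompact_sdiff_lt hDfin hε₁'
  -- an open `O ⊇ D`, `O ⊆ U'`, with `ρ(O ∖ D) < ε₁`
  obtain ⟨O₁, hDO₁, hO₁o, -, hO₁ρ⟩ := hDm.exists_isOpen_sdiff_lt (μ := ρ) hρDfin hε₁'
  set O : Set P := O₁ ∩ U' with hOdef
  have hOo : IsOpen O := hO₁o.inter hU'
  have hDO : D ⊆ O := subset_inter hDO₁ sdiff_subset
  have hKO : K ⊆ O := hKD.trans hDO
  -- a smooth Urysohn function
  obtain ⟨g₀, V₀, -, hKV₀, hg₀1, hg₀01⟩ :=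
    exists_testFunction_eq_one_nhds (Ω := ⟨O, hOo⟩) hKc hKO
  set g : 𝓓((⊤ : Opens P), ℝ) := TestFunction.monoCLM ℝ g₀ with hgdef
  have hgg₀ : (g : P → ℝ) = g₀ := by
    rw [hgdef, TestFunction.monoCLM_apply, if_pos ⟨le_rfl, le_top⟩]
  have hgO : tsupport (g : P → ℝ) ⊆ O := by rw [hgg₀]; exact g₀.tsupport_subset
  have hgU' : tsupport (g : P → ℝ) ⊆ U' := hgO.trans inter_subset_right
  have hg01 : ∀ y, g y ∈ Icc (0 : ℝ) 1 := fun y => by rw [hgg₀]; exact hg₀01 y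
  have hg1 : ∀ y, |g y| ≤ 1 := fun y => abs_le.2 ⟨by linarith [(hg01 y).1], (hg01 y).2⟩
  have hgK : ∀ y ∈ K, g y = 1 := fun y hy => by rw [hgg₀]; exact hg₀1 y (hKV₀ hy)
  -- (a) `∫ g ≥ vol(K)`
  have hgint : Integrable (g : P → ℝ) volume :=
    g.continuous.integrable_of_hasCompactSupport g.hasCompactSupport
  have hKm : MeasurableSet K := hKc.isClosed.measurableSet
  have ha : (volume K).toReal ≤ ∫ y, g y ∂volume := by
    have h1 : ∫ y, K.indicator (1 : P → ℝ) y ∂volume = (volume K).toReal := by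
      rw [integral_indicator_one hKm]; rfl
    rw [← h1]
    have hKfin' : volume K < ⊤ := (measure_mono hKD).trans_lt hDfin.lt_top
    refine integral_mono ((integrable_indicator_iff hKm).2
      ((integrableOn_const_iff (C := (1 : ℝ))).2 (Or.inr hKfin'))) hgint fun y => ?_
    by_cases hy : y ∈ K
    · rw [indicator_of_mem hy, Pi.one_apply, hgK y hy]
    · rw [indicator_of_notMem hy]; exact (hg01 y).1
  -- (b) `|Λ g| ≤ ρ(O ∖ D) < ε₁`
  have hb : |Λ g| ≤ ε₁ := by
    refine (hΛ g hgU' hg1).trans ?_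
    have hsub : Function.support (g : P → ℝ) ∩ F ⊆ O₁ \ D := by
      rintro y ⟨hy, hyF⟩
      have hyO : y ∈ O := hgO (subset_tsupport _ hy)
      exact ⟨hyO.1, fun hyD => hyD.2 hyF⟩
    calc (ρ (Function.support (g : P → ℝ) ∩ F)).toReal ≤ (ρ (O₁ \ D)).toReal :=
          ENNReal.toReal_mono (measure_ne_top ρ _) (measure_mono hsub)
      _ ≤ (ENNReal.ofReal ε₁).toReal := ENNReal.toReal_mono ENNReal.ofReal_ne_top hO₁ρ.le
      _ = ε₁ := ENNReal.toReal_ofReal hε₁0.le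
  -- (c) `vol(D) ≤ vol(K) + ε₁`
  have hc : (volume D).toReal ≤ (volume K).toReal + ε₁ := by
    have h1 : volume D ≤ volume K + volume (D \ K) := by
      calc volume D ≤ volume (K ∪ (D \ K)) := measure_mono (by
            intro y hy; by_cases hyK : y ∈ K
            · exact Or.inl hyK
            · exact Or.inr ⟨hy, hyK⟩)
        _ ≤ volume K + volume (D \ K) := measure_union_le _ _
    have hKfin : volume K ≠ ⊤ := measure_ne_top_of_subset hKD hDfin
    have hDKfin : volume (D \ K) ≠ ⊤ := measure_ne_top_of_subset sdiff_subset hDfin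
    calc (volume D).toReal ≤ (volume K + volume (D \ K)).toReal :=
          ENNReal.toReal_mono (ENNReal.add_ne_top.2 ⟨hKfin, hDKfin⟩) h1
      _ = (volume K).toReal + (volume (D \ K)).toReal := ENNReal.toReal_add hKfin hDKfin
      _ ≤ (volume K).toReal + ε₁ := by
          gcongr
          calc (volume (D \ K)).toReal ≤ (ENNReal.ofReal ε₁).toReal :=
                ENNReal.toReal_mono ENNReal.ofReal_ne_top hKvol.le
            _ = ε₁ := ENNReal.toReal_ofReal hε₁0.le
  -- combine
  have hmain := hη g hgU' hg1
  have hβg : |β| * ∫ y, g y ∂volume ≤ η + ε₁ := by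
    have hint0 : 0 ≤ ∫ y, g y ∂volume := integral_nonneg fun y => (hg01 y).1
    calc |β| * ∫ y, g y ∂volume = |β * ∫ y, g y ∂volume| := by
          rw [abs_mul, abs_of_nonneg hint0]
      _ ≤ |Λ g - β * ∫ y, g y ∂volume| + |Λ g| := by
          have := abs_sub_abs_le_abs_sub (β * ∫ y, g y ∂volume) (Λ g)
          rw [abs_sub_comm] at this
          linarith
      _ ≤ η + ε₁ := add_le_add hmain hb
  calc |β| * (volume D).toReal ≤ |β| * ((volume K).toReal + ε₁) :=
        mul_le_mul_of_nonneg_left hc (abs_nonneg _)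
    _ = |β| * (volume K).toReal + |β| * ε₁ := mul_add _ _ _
    _ ≤ |β| * (∫ y, g y ∂volume) + |β| * ε₁ := by gcongr
    _ ≤ η + ε₁ + |β| * ε₁ := by linarith
    _ = η + ε := by rw [hε₁]; field_simp; ring

end Carrier

/-! ### The multiplicity of a sheet is at least one -/

section Multiplicity

variable {σ : Measure V} {ξ : V → Multivector V (k + 1)} {a : V} {lam : ℕ → ℝ} {ν : Measure V}
  [IsFiniteMeasure σ] [IsLocallyFiniteMeasure ν]

omit [IsFiniteMeasure σ] in
/-- **The projected current lives over the projection of the carrier.** With `T_l = σ_l ∧ ξ_l`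
(`σ_l = σ_{a,λ_l}` carried by `M_l`, `ξ_l = ξ ∘ D_l`) and `F ⊇ Π(M_l ∩ spt G ∩ Π⁻¹ U')`: for every
test function `g` on `W` supported in `U'`,
`|Π_#(T_l ⌞ G)(g e^♭)| ≤ ‖T_l‖(spt G ∩ Π⁻¹(spt g ∩ F))` (`0 ≤ G ≤ 1`, `|χ| ≤ 1`, `|g| ≤ 1`).
[cite: White1989, p. 219] -/
theorem abs_projectedBlowUp_apply_le_variation (hξ : Integrable ξ σ) (W : Submodule ℝ V)
    (e : OrthonormalBasis (Fin (k + 1)) ℝ W) {r : ℝ} (hr : 0 < r) (G χ : 𝓓((⊤ : Opens V), ℝ))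
    (hG01 : ∀ x, G x ∈ Icc (0 : ℝ) 1) (hχ1 : ∀ x, |χ x| ≤ 1) {M_l : Set V}
    (hM_l : Measure.blowUp σ (k + 1) a r M_lᶜ = 0) {U' : Set W} {F : Set W}
    (hFm : MeasurableSet F)
    (hF : W.orthogonalProjectionOnto '' (M_l ∩ tsupport ⇑G ∩ W.orthogonalProjectionOnto ⁻¹' U') ⊆ F)
    (g : 𝓓((⊤ : Opens W), ℝ)) (hgU' : tsupport (g : W → ℝ) ⊆ U') (hg1 : ∀ y, |g y| ≤ 1) :
    |(((blowUpCurrent σ ξ a r).smulFun G.contDiff).pushforward ⊤ χ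
        W.orthogonalProjectionOnto.contDiff) (smulCovectorCLM (frameCovector e) g)| ≤
      ((blowUpCurrent σ ξ a r).variation
        (tsupport ⇑G ∩ W.orthogonalProjectionOnto ⁻¹' (Function.support (g : W → ℝ) ∩ F))).toReal := by
  set P := W.orthogonalProjectionOnto with hPdef
  set σl := Measure.blowUp σ (k + 1) a r with hσl
  set ξl : V → Multivector V (k + 1) := fun y => ξ (a + r • y) with hξl
  set eV : Fin (k + 1) → V := fun i => (e i : V) with heV
  have hξl : Integrable ξl σl := integrable_comp_blowUp hξ a hr
  set B : Set V := tsupport ⇑G ∩ P ⁻¹' (Function.support (g : W → ℝ) ∩ F) with hB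
  have hBm : MeasurableSet B :=
    (isClosed_tsupport _).measurableSet.inter
      ((g.continuous.isOpen_support.measurableSet.inter hFm).preimage P.continuous.measurable)
  -- the integral formula
  have hform : (((blowUpCurrent σ ξ a r).smulFun G.contDiff).pushforward ⊤ χ P.contDiff)
      (smulCovectorCLM (frameCovector e) g) =
      ∫ x, G x * χ x * g (P x) * ξl x (frameCovector eV) ∂σl := by
    rw [blowUpCurrent]
    exact pushforward_smulFun_vectorCurrent_apply_smul_frameCovector W
      (hξl.locallyIntegrable.locallyIntegrableOn _) G χ e g
  rw [hform]
  -- pointwise a.e. bound by `1_B ‖ξ_l‖`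
  have hae : ∀ᵐ x ∂σl, ‖G x * χ x * g (P x) * ξl x (frameCovector eV)‖ ≤
      B.indicator (fun x => ‖ξl x‖) x := by
    have hMl : ∀ᵐ x ∂σl, x ∈ M_l := by
      rw [ae_iff]; exact hM_l
    filter_upwards [hMl] with x hxM
    by_cases hx : x ∈ B
    · rw [indicator_of_mem hx, norm_mul, norm_mul, norm_mul]
      have h1 : ‖G x‖ ≤ 1 := by
        rw [Real.norm_eq_abs, abs_of_nonneg (hG01 x).1]; exact (hG01 x).2
      have h2 : ‖χ x‖ ≤ 1 := hχ1 x
      have h3 : ‖g (P x)‖ ≤ 1 := hg1 _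
      have h4 : ‖ξl x (frameCovector eV)‖ ≤ ‖ξl x‖ := by
        refine ((ξl x).le_opNorm _).trans ?_
        exact mul_le_of_le_one_right (norm_nonneg _)
          (norm_frameCovector_le_one (orthonormal_subtype_val_comp e.orthonormal))
      calc ‖G x‖ * ‖χ x‖ * ‖g (P x)‖ * ‖ξl x (frameCovector eV)‖ ≤ 1 * 1 * 1 * ‖ξl x‖ := by
            gcongr
        _ = ‖ξl x‖ := by ring
    · rw [indicator_of_notMem hx]
      -- off `B` the integrand vanishes (for `x ∈ M_l`)
      suffices h0 : G x * χ x * g (P x) * ξl x (frameCovector eV) = 0 by rw [h0, norm_zero]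
      by_cases hGx : G x = 0
      · simp [hGx]
      by_cases hgx : g (P x) = 0
      · simp [hgx]
      exfalso
      refine hx ⟨subset_tsupport _ hGx, ?_⟩
      refine ⟨hgx, hF ⟨x, ⟨⟨hxM, subset_tsupport _ hGx⟩, ?_⟩, rfl⟩⟩
      exact hgU' (subset_tsupport _ hgx)
  have hint : Integrable (fun x => B.indicator (fun x => ‖ξl x‖) x) σl :=
    hξl.norm.indicator hBm
  calc |∫ x, G x * χ x * g (P x) * ξl x (frameCovector eV) ∂σl|
      ≤ ∫ x, B.indicator (fun x => ‖ξl x‖) x ∂σl := by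
        rw [← Real.norm_eq_abs]; exact norm_integral_le_of_norm_le hint hae
    _ = ((blowUpCurrent σ ξ a r).variation B).toReal := by
        rw [integral_indicator hBm, variation_blowUpCurrent hξ a hr, withDensity_apply _ hBm,
          integral_norm_eq_lintegral_enorm hξl.1.restrict]

/-- **Every sheet of the blow-up limit has multiplicity at least one** [White1989, p. 219:
"`ℒᵏ(U) ≤ … ≤ α_j ℋᵏ(U)`, which implies `α_j ≥ 1`"; Bandara2006, pp. 43–44]. Let `σ` be finite with
the projection hypothesis relative to `W` on a carrier `M` (`σ(Mᶜ) = 0`,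
`𝓗^{k+1}(P_W A) ≤ σ(A)` for `A ⊆ M`), `T = σ ∧ ξ` a cycle, `σ_{a,λ_l} → ν` vaguely (`λ_l ↓ 0`),
`a` a normalised Lebesgue point of `ξ`, `dim W = k + 1` with orthonormal basis `e` and
`⟨e^♭, ξ(a)⟩ ≠ 0`, and `z ∈ Wᗮ` a sheet: `ν ⌞ {dist(P_{Wᗮ}·, z) < δ} = α 𝓗^{k+1} ⌞ (z + W)` with
`δ > 0`, `α ≠ 0`. Then `1 ≤ α`. [cite: White1989, p. 219; Bandara2006, Thm. 4.2.1] -/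
theorem one_le_sheetMultiplicity (hξ : Integrable ξ σ)
    (hT : (vectorCurrent σ ξ : Current (⊤ : Opens V) (k + 1)).boundary = 0)
    (hlam : ∀ l, 0 < lam l) (hlam0 : Tendsto lam atTop (𝓝 0))
    (hv : Measure.VagueTendsto (fun l => Measure.blowUp σ (k + 1) a (lam l)) ν)
    (hLeb : Tendsto (fun r => (r⁻¹) ^ (k + 1) * ∫ x in closedBall a r, ‖ξ x - ξ a‖ ∂σ)
      (𝓝[>] 0) (𝓝 0))
    (W : Submodule ℝ V) (hdim : Module.finrank ℝ W = k + 1)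
    (e : OrthonormalBasis (Fin (k + 1)) ℝ W) (hc₀ : (ξ a) (frameCovector fun i => (e i : V)) ≠ 0)
    {M : Set V} (hM : σ Mᶜ = 0)
    (hproj : ∀ A ⊆ M, (μHE[k + 1] : Measure V) (W.starProjection '' A) ≤ σ A)
    {z : V} (hz : z ∈ Wᗮ) {δ : ℝ} (hδ : 0 < δ) {α : ℝ≥0} (hα : α ≠ 0)
    (hsheet : ν.restrict {x | dist (Wᗮ.starProjection x) z < δ} =
      (α : ℝ≥0∞) • (μHE[k + 1] : Measure V).restrict {x | x - z ∈ W}) :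
    1 ≤ α := by
  set P := W.orthogonalProjectionOnto with hPdef
  haveI : Nontrivial W := Module.nontrivial_of_finrank_eq_succ hdim
  -- parameters: `ε = δ/4`, `R = 1`, the cutoff `G`, the cutoff `χ`
  set ε : ℝ := δ / 4 with hεdef
  have hε : 0 < ε := by positivity
  have h2ε : 2 * ε < δ := by rw [hεdef]; linarith
  obtain ⟨G, hG01, ⟨O, hO, hKO, hG1⟩, hGsupp2⟩ := exists_sheetCutoff W z hε one_pos
  have hGsupp : tsupport ⇑G ⊆ {x : V | dist (Wᗮ.starProjection x) z < 2 * ε} :=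
    fun x hx => (hGsupp2 hx).2
  obtain ⟨χ, U₀, hU₀, hGU₀, hχ, hχ01⟩ :=
    exists_testFunction_eq_one_nhds (Ω := (⊤ : Opens V)) G.hasCompactSupport (subset_univ _)
  have hχ1 : ∀ x, |χ x| ≤ 1 := fun x => abs_le.2 ⟨by linarith [(hχ01 x).1], (hχ01 x).2⟩
  -- the disc `U' = B_W(0, 1/2)` and its volume
  set U' : Set W := ball (0 : W) (1 / 2) with hU'def
  have hU'o : IsOpen U' := isOpen_ball
  have hU'm : MeasurableSet U' := measurableSet_ball
  have hU'b : Bornology.IsBounded U' := isBounded_ball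
  have hU'U : cthickening (2 * (1 / 8 : ℝ)) U' ⊆ ball (0 : W) 1 := by
    rw [hU'def, cthickening_ball (by norm_num) (by norm_num)]
    exact closedBall_subset_ball (by norm_num)
  have hvolU'pos : volume U' ≠ 0 := (measure_ball_pos volume (0 : W) (by norm_num)).ne'
  have hvolU'top : volume U' ≠ ⊤ := measure_ball_lt_top.ne
  -- `β = α c₀ ≠ 0`
  set c₀ : ℝ := (ξ a) (frameCovector fun i => (e i : V)) with hc₀def
  set β : ℝ := (α : ℝ) * c₀ with hβdef
  have hβ : β ≠ 0 := mul_ne_zero (NNReal.coe_ne_zero.2 hα) hc₀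
  have hβpos : 0 < |β| := abs_pos.2 hβ
  -- the compact slab over the closed disc, and its `ν`-measure
  set K₃ : Set V := {x : V | ‖W.starProjection x‖ ≤ 1 / 2 ∧ 0 ≤ dist (Wᗮ.starProjection x) z ∧
    dist (Wᗮ.starProjection x) z ≤ 2 * ε} with hK₃def
  have hK₃c : IsCompact K₃ := isCompact_cylinderShell W z (1 / 2) 0 (2 * ε)
  have hK₃m : MeasurableSet K₃ := hK₃c.isClosed.measurableSet
  have hνK₃ : ν K₃ = (α : ℝ≥0∞) * volume U' := by
    have hsub : K₃ ⊆ {x | dist (Wᗮ.starProjection x) z < δ} := fun x hx => by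
      change dist (Wᗮ.starProjection x) z < δ; linarith [hx.2.2]
    rw [← inter_eq_self_of_subset_left hsub, ← Measure.restrict_apply hK₃m, hsheet,
      Measure.smul_apply, smul_eq_mul]
    congr 1
    have hset : K₃ ∩ {x : V | x - z ∈ W} = P ⁻¹' closedBall (0 : W) (1 / 2) ∩ {x : V | x - z ∈ W} := by
      ext x
      constructor
      · rintro ⟨⟨h1, -, -⟩, hxA⟩
        refine ⟨?_, hxA⟩
        rw [mem_preimage, mem_closedBall, dist_zero_right, ← Submodule.norm_coe,
          ← Submodule.starProjection_apply]
        exact h1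
      · rintro ⟨h1, hxA⟩
        have hPx : Wᗮ.starProjection x = z := by
          have hxz : x = z + (x - z) := by abel
          rw [hxz, map_add, Submodule.starProjection_orthogonal_apply_eq_zero hxA, add_zero]
          exact Submodule.starProjection_eq_self_iff.2 hz
        rw [mem_preimage, mem_closedBall, dist_zero_right, ← Submodule.norm_coe,
          ← Submodule.starProjection_apply] at h1
        refine ⟨⟨h1, dist_nonneg, ?_⟩, hxA⟩
        rw [hPx, dist_self]; positivity
    rw [Measure.restrict_apply hK₃m, hset, ← Measure.restrict_apply (measurableSet_closedBall.preimage
      P.continuous.measurable), euclideanHausdorffMeasure_restrict_plane_preimage W hdim hz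
      measurableSet_closedBall, hU'def, Measure.addHaar_closedBall_eq_addHaar_ball]
  have hνK₃top : ν K₃ ≠ ⊤ := hK₃c.measure_lt_top.ne
  -- Main estimate: `vol U' ≤ α vol U' + ε₀` for every `ε₀ > 0`
  have hkey : ∀ ε₀ : ℝ≥0, 0 < ε₀ → volume U' ≤ (α : ℝ≥0∞) * volume U' + ε₀ := by
    intro ε₀ hε₀
    have hε₀2 : (0 : ℝ≥0∞) < (ε₀ : ℝ≥0∞) / 2 := ENNReal.half_pos (ENNReal.coe_ne_zero.2 hε₀.ne')
    -- `η` with `η / |β| = ε₀ / 2`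
    set η : ℝ := (ε₀ : ℝ) / 2 * |β| with hηdef
    have hη : 0 < η := by positivity
    have hηβ : ENNReal.ofReal (η / |β|) = (ε₀ : ℝ≥0∞) / 2 := by
      rw [hηdef, mul_div_cancel_right₀ _ hβpos.ne', ENNReal.ofReal_div_of_pos two_pos,
        ENNReal.ofReal_coe_nnreal, ENNReal.ofReal_ofNat]
    -- the projection step, eventually
    have hev1 := eventually_forall_abs_projectedBlowUp_sub_le hξ hT hlam hlam0 hv hLeb W hdim e hz
      hsheet hε h2ε G χ hG01 hO hKO hG1 hGsupp hU₀ hGU₀ hχ hχ1 hU'm hU'b (by norm_num : (0:ℝ) < 1/8)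
      hU'U hη
    -- `σ_l(K₃) < ν(K₃) + ε₀/2`, eventually
    have hev2 : ∀ᶠ l in atTop, Measure.blowUp σ (k + 1) a (lam l) K₃ < ν K₃ + (ε₀ : ℝ≥0∞) / 2 :=
      eventually_lt_of_limsup_lt ((hv.limsup_measure_le_of_isCompact hK₃c).trans_lt
        (ENNReal.lt_add_right hνK₃top hε₀2.ne'))
    obtain ⟨l, hl1, hl2⟩ := (hev1.and hev2).exists
    -- the carrier `A_l`, its projection `E_l`, a measurable hull `F_l`
    set r := lam l with hrdef
    have hr : 0 < r := hlam l
    set M_l : Set V := (fun y : V => a + r • y) ⁻¹' M with hM_ldef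
    have hM_l : Measure.blowUp σ (k + 1) a r M_lᶜ = 0 := blowUp_compl_preimage_eq_zero hM _ a hr
    set A_l : Set V := M_l ∩ tsupport ⇑G ∩ P ⁻¹' U' with hA_ldef
    set E_l : Set W := P '' A_l with hE_ldef
    set F_l : Set W := toMeasurable volume E_l with hF_ldef
    have hF_lm : MeasurableSet F_l := measurableSet_toMeasurable _ _
    have hEF : E_l ⊆ F_l := subset_toMeasurable _ _
    -- (i) `vol(F_l) = vol(E_l) ≤ σ_l(A_l) ≤ σ_l(K₃)`
    have hvolF : volume F_l ≤ Measure.blowUp σ (k + 1) a r K₃ := by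
      rw [hF_ldef, measure_toMeasurable]
      have h1 : volume E_l = (μHE[k + 1] : Measure V) (W.starProjection '' A_l) := by
        have hvol : (volume : Measure W) = μHE[k + 1] := by
          rw [← hdim]; exact InnerProductSpace.euclideanHausdorffMeasure_eq_volume.symm
        rw [hvol, ← isometry_subtype_coe.euclideanHausdorffMeasure_image, hE_ldef, image_image]
        rfl
      rw [h1]
      refine (blowUp_projection_le W hproj a hr (A' := A_l) fun x hx => hx.1.1).trans ?_
      refine measure_mono fun x hx => ?_
      obtain ⟨⟨-, hxG⟩, hxU⟩ := hx
      refine ⟨?_, dist_nonneg, (hGsupp hxG).le⟩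
      rw [mem_preimage, hU'def, mem_ball, dist_zero_right] at hxU
      rw [Submodule.starProjection_apply, Submodule.norm_coe]
      exact hxU.le
    -- (ii) `vol(U' ∖ F_l) ≤ ε₀/2` by the carrier lemma
    set ρ : Measure W := Measure.map P ((blowUpCurrent σ ξ a r).variation.restrict (tsupport ⇑G))
      with hρdef
    haveI : IsFiniteMeasure (blowUpCurrent σ ξ a r).variation :=
      (blowUpCurrent σ ξ a r).isFiniteMeasure_variation (mass_blowUpCurrent_ne_top hξ a hr)
    haveI : IsFiniteMeasure ρ := by
      rw [hρdef]; exact Measure.isFiniteMeasure_map _ _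
    have hΛ : ∀ g : 𝓓((⊤ : Opens W), ℝ), tsupport (g : W → ℝ) ⊆ U' → (∀ y, |g y| ≤ 1) →
        |(((blowUpCurrent σ ξ a r).smulFun G.contDiff).pushforward ⊤ χ P.contDiff)
          (smulCovectorCLM (frameCovector e) g)| ≤
          (ρ (Function.support (g : W → ℝ) ∩ F_l)).toReal := by
      intro g hgU' hg1
      refine (abs_projectedBlowUp_apply_le_variation hξ W e hr G χ hG01 hχ1 hM_l hF_lm hEF g hgU'
        hg1).trans (le_of_eq ?_)
      have hsm : MeasurableSet (Function.support (g : W → ℝ) ∩ F_l) :=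
        g.continuous.isOpen_support.measurableSet.inter hF_lm
      rw [hρdef, Measure.map_apply P.continuous.measurable hsm,
        Measure.restrict_apply (hsm.preimage P.continuous.measurable), inter_comm]
    have hcar := abs_mul_volumeReal_sdiff_le_of_forall_testFunction hU'o hvolU'top hF_lm ρ _ hΛ hl1
    have hvolD : volume (U' \ F_l) ≤ (ε₀ : ℝ≥0∞) / 2 := by
      have hfin : volume (U' \ F_l) ≠ ⊤ := measure_ne_top_of_subset sdiff_subset hvolU'top
      rw [← hηβ, ← ENNReal.ofReal_toReal hfin]
      refine ENNReal.ofReal_le_ofReal ?_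
      rw [le_div_iff₀ hβpos, mul_comm]
      exact hcar
    -- (iii) combine
    calc volume U' ≤ volume (F_l ∪ (U' \ F_l)) := measure_mono (by
          intro y hy; by_cases hyF : y ∈ F_l
          · exact Or.inl hyF
          · exact Or.inr ⟨hy, hyF⟩)
      _ ≤ volume F_l + volume (U' \ F_l) := measure_union_le _ _
      _ ≤ Measure.blowUp σ (k + 1) a r K₃ + (ε₀ : ℝ≥0∞) / 2 := add_le_add hvolF hvolD
      _ ≤ (ν K₃ + (ε₀ : ℝ≥0∞) / 2) + (ε₀ : ℝ≥0∞) / 2 := by gcongr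
      _ = (α : ℝ≥0∞) * volume U' + ε₀ := by rw [hνK₃, add_assoc, ENNReal.add_halves]
  have hle : volume U' ≤ (α : ℝ≥0∞) * volume U' :=
    ENNReal.le_of_forall_pos_le_add fun ε₀ hε₀ _ => hkey ε₀ hε₀
  have h1 : (1 : ℝ≥0∞) * volume U' ≤ (α : ℝ≥0∞) * volume U' := by rwa [one_mul]
  have h2 : (1 : ℝ≥0∞) ≤ (α : ℝ≥0∞) := (ENNReal.mul_le_mul_iff_left hvolU'pos hvolU'top).1 h1
  exact_mod_cast h2

end Multiplicity

end Literature.Geometry.GeometricMeasureTheory
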